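import Literature.Probability.LatticeModels.IsingDisorderLaplacian
import Literature.Probability.LatticeModels.LeftmostInterfaceTightness
import Literature.Probability.LatticeModels.WeakBeurlingEstimate
import HarnessLib

/-!
# The Kadanoff–Ceva data only depend on the neighbourhoods of the free sites: `Ω_δ` versus `ℤ²`

Topic `Literature/Probability/LatticeModels`. The Kadanoff–Ceva corner values, fluxes, primitives
and admissible cut systems of the programme behind `chi_onePoint_rho` / `chi_twoPoint_free_jordan`
(`IsingDisorderFermion.lean`, `IsingDisorderLaplacian.lean`) are stated for a general locally finite
graph `G₂` on `ℤ²` (the discrete domain graph `discreteDomainGraph Ω δ` of Chelkak–Hongler–Izyurov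
2015, §1.2, in the applications), while the Kramers–Wannier and Griffiths estimates
(`KramersWannierDisorder.lean`, `KCCornerDecay.lean`, `KCBoundarySmallness.lean`) are proved on
`zdGraph 2`. Since the fixed-boundary-condition Gibbs measure in the volume `Λ` only depends on the
edges touching `Λ` (`isingMeasure_fixed_congr_graph`, Friedli–Velenik 2017, §3.1, eq. (3.6)), all
these objects coincide for two graphs in which the sites of `Λ` have the same neighbours — in
particular for `discreteDomainGraph Ω δ` and `zdGraph 2` on any `Λ ⊆ meshInteriorFinset Ω δ`
(a free site of `Ω_δ` is joined to its four lattice neighbours):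

* `edgeBoundary_congr_graph`, `kcCorner_congr_graph`, `kcFlux_congr_graph`,
  `isKCPrimitive_congr_graph`, `KCGaugeEquiv.congr_graph`, `isKCCuts_congr_graph`;
* `adj_iff_of_mem_meshInteriorFinset` and the specialisations `kcCorner_discreteDomainGraph_eq`,
  `isKCPrimitive_discreteDomainGraph_iff`, `isKCCuts_discreteDomainGraph_iff` for
  `Λ ⊆ meshInteriorFinset Ω δ`.

Everything is proved; no named fact.

## References

* S. Friedli, Y. Velenik, *Statistical Mechanics of Lattice Systems* (2017), §3.1, eq. (3.6)
  — `FriedliVelenik2017`.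
* D. Chelkak, C. Hongler, K. Izyurov, Ann. of Math. 181 (2015) = arXiv:1202.2838, §1.2, §2.1
  — `ChelkakHonglerIzyurovAnnals2015`.
-/

noncomputable section

namespace Literature.Probability.LatticeModels

open Finset SimpleGraph

/-! ### Two graphs with the same neighbourhoods of the free sites -/

section Congr

variable {G G' : SimpleGraph (Site 2)} [G.LocallyFinite] [G'.LocallyFinite] {Λ : Finset (Site 2)}

/-- The edge boundary of a set of free sites only depends on their neighbourhoods. [cite: FriedliVelenik2017, §3.1] -/
theorem edgeBoundary_congr_graph (h : ∀ x ∈ Λ, ∀ y, G.Adj x y ↔ G'.Adj x y) {S : Finset (Site 2)} (hS : S ⊆ Λ) :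
    edgeBoundary G S = edgeBoundary G' S := by
  ext e
  induction e using Sym2.ind with
  | h a b =>
    rw [mk_mem_edgeBoundary_iff, mk_mem_edgeBoundary_iff]
    refine and_congr_left fun hab => ?_
    by_cases ha : a ∈ S
    · exact h a (hS ha) b
    · have hb : b ∈ S := by tauto
      rw [G.adj_comm, G'.adj_comm]
      exact h b (hS hb) a

/-- **Corner values only depend on the neighbourhoods of the free sites.** [cite: FriedliVelenik2017, §3.1, eq. (3.6)] -/
theorem kcCorner_congr_graph (h : ∀ x ∈ Λ, ∀ y, G.Adj x y ↔ G'.Adj x y) (β : ℝ) (η : SpinConfig (Site 2))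
    (B : Finset (Site 2)) (T : Finset (Sym2 (Site 2))) (v : Site 2) :
    kcCorner G Λ β (.fixed η) B T v = kcCorner G' Λ β (.fixed η) B T v := by
  unfold kcCorner isingExpect
  rw [isingMeasure_fixed_congr_graph h]

/-- Fluxes only depend on the neighbourhoods of the free sites. [cite: FriedliVelenik2017, §3.1, eq. (3.6)] -/
theorem kcFlux_congr_graph (h : ∀ x ∈ Λ, ∀ y, G.Adj x y ↔ G'.Adj x y) (β : ℝ) (η : SpinConfig (Site 2))
    (B : Finset (Site 2)) (cut : Site 2 → Finset (Sym2 (Site 2))) (q : Site 2 × Fin 4) :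
    kcFlux G Λ β (.fixed η) B cut q = kcFlux G' Λ β (.fixed η) B cut q := by
  unfold kcFlux
  rw [kcCorner_congr_graph h]

/-- **Primitive pairs only depend on the neighbourhoods of the free sites.** [cite: ChelkakHonglerIzyurovAnnals2015, Prop. 3.6] -/
theorem isKCPrimitive_congr_graph (h : ∀ x ∈ Λ, ∀ y, G.Adj x y ↔ G'.Adj x y) {β : ℝ} {η : SpinConfig (Site 2)}
    {B : Finset (Site 2)} {cut : Site 2 → Finset (Sym2 (Site 2))} {Hw Hb : Site 2 → ℝ} {P : Set (Site 2)} :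
    IsKCPrimitive G Λ β (.fixed η) B cut Hw Hb P ↔ IsKCPrimitive G' Λ β (.fixed η) B cut Hw Hb P := by
  unfold IsKCPrimitive
  simp only [kcFlux_congr_graph h]

/-- Gauge equivalence only depends on the neighbourhoods of the free sites. [cite: ChelkakHonglerIzyurov2021, Lemma 2.4] -/
theorem KCGaugeEquiv.congr_graph (h : ∀ x ∈ Λ, ∀ y, G.Adj x y ↔ G'.Adj x y) {T T' : Finset (Sym2 (Site 2))}
    (hg : KCGaugeEquiv G Λ T T') : KCGaugeEquiv G' Λ T T' := by
  obtain ⟨S, hS, rfl⟩ := hg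
  exact ⟨S, hS, by rw [edgeBoundary_congr_graph h hS]⟩

/-- **Admissible cut systems only depend on the neighbourhoods of the free sites.** [cite: ChelkakHonglerIzyurov2021, §2.2] -/
theorem IsKCCuts.congr_graph (h : ∀ x ∈ Λ, ∀ y, G.Adj x y ↔ G'.Adj x y) {cut : Site 2 → Finset (Sym2 (Site 2))}
    {P : Set (Site 2)} (hc : IsKCCuts G Λ cut P) : IsKCCuts G' Λ cut P := by
  have hE : edgesTouching G Λ = edgesTouching G' Λ := edgesTouching_congr h
  refine ⟨fun p hp => hE ▸ hc.subset p hp, fun u k hk hk3 => ?_⟩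
  rcases hc.step u k hk hk3 with ⟨hsrc, S, hS, hstep⟩ | hfro
  · exact Or.inl ⟨hE ▸ hsrc, S, hS, by rw [hstep, edgeBoundary_congr_graph h hS]⟩
  · exact Or.inr hfro

/-- The `iff` form. [cite: ChelkakHonglerIzyurov2021, §2.2] -/
theorem isKCCuts_congr_graph (h : ∀ x ∈ Λ, ∀ y, G.Adj x y ↔ G'.Adj x y) {cut : Site 2 → Finset (Sym2 (Site 2))}
    {P : Set (Site 2)} : IsKCCuts G Λ cut P ↔ IsKCCuts G' Λ cut P :=
  ⟨fun hc => hc.congr_graph h, fun hc => hc.congr_graph fun x hx y => (h x hx y).symm⟩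

end Congr

/-! ### `Ω_δ` versus `ℤ²` on subsets of the free volume -/

section Mesh

variable {Ω : Set ℂ} {δ : ℝ} {Λ : Finset (Site 2)}

/-- **A free site of `Ω_δ` has the same neighbours in `Ω_δ` as in `ℤ²`.** [cite: ChelkakHonglerIzyurovAnnals2015, §1.2] -/
theorem adj_iff_of_mem_meshInteriorFinset {x : Site 2} (hx : x ∈ meshInteriorFinset Ω δ) (y : Site 2) :
    (discreteDomainGraph Ω δ).Adj x y ↔ (zdGraph 2).Adj x y := by
  refine ⟨fun h => discreteDomainGraph_le_zdGraph Ω δ h, fun h => ?_⟩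
  obtain ⟨k, rfl⟩ := WeakBeurling.exists_eq_add_cornerUnit_of_adj h
  exact discreteDomainGraph_adj_of_mem_meshInteriorFinset hx k

/-- The hypothesis of the `congr_graph` lemmas for `Λ ⊆ meshInteriorFinset Ω δ`. [cite: ChelkakHonglerIzyurovAnnals2015, §1.2] -/
theorem adj_iff_of_subset_meshInteriorFinset (hΛ : Λ ⊆ meshInteriorFinset Ω δ) :
    ∀ x ∈ Λ, ∀ y, (discreteDomainGraph Ω δ).Adj x y ↔ (zdGraph 2).Adj x y :=
  fun _ hx y => adj_iff_of_mem_meshInteriorFinset (hΛ hx) y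

/-- **Corner values of `Ω_δ` are corner values of `ℤ²`** on any set of free sites of `Ω_δ`.
[cite: ChelkakHonglerIzyurovAnnals2015, §1.2 and Def. 2.1] -/
theorem kcCorner_discreteDomainGraph_eq (hΛ : Λ ⊆ meshInteriorFinset Ω δ) (β : ℝ) (η : SpinConfig (Site 2))
    (B : Finset (Site 2)) (T : Finset (Sym2 (Site 2))) (v : Site 2) :
    kcCorner (discreteDomainGraph Ω δ) Λ β (.fixed η) B T v = kcCorner (zdGraph 2) Λ β (.fixed η) B T v :=
  kcCorner_congr_graph (adj_iff_of_subset_meshInteriorFinset hΛ) β η B T v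

/-- Primitive pairs of `Ω_δ` are primitive pairs of `ℤ²` on any set of free sites of `Ω_δ`. [cite: ChelkakHonglerIzyurovAnnals2015, Prop. 3.6] -/
theorem isKCPrimitive_discreteDomainGraph_iff (hΛ : Λ ⊆ meshInteriorFinset Ω δ) {β : ℝ} {η : SpinConfig (Site 2)}
    {B : Finset (Site 2)} {cut : Site 2 → Finset (Sym2 (Site 2))} {Hw Hb : Site 2 → ℝ} {P : Set (Site 2)} :
    IsKCPrimitive (discreteDomainGraph Ω δ) Λ β (.fixed η) B cut Hw Hb P ↔
      IsKCPrimitive (zdGraph 2) Λ β (.fixed η) B cut Hw Hb P :=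
  isKCPrimitive_congr_graph (adj_iff_of_subset_meshInteriorFinset hΛ)

/-- Admissible cut systems of `Ω_δ` are admissible cut systems of `ℤ²` on any set of free sites of `Ω_δ`.
[cite: ChelkakHonglerIzyurov2021, §2.2] -/
theorem isKCCuts_discreteDomainGraph_iff (hΛ : Λ ⊆ meshInteriorFinset Ω δ) {cut : Site 2 → Finset (Sym2 (Site 2))}
    {P : Set (Site 2)} :
    IsKCCuts (discreteDomainGraph Ω δ) Λ cut P ↔ IsKCCuts (zdGraph 2) Λ cut P :=
  isKCCuts_congr_graph (adj_iff_of_subset_meshInteriorFinset hΛ)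

end Mesh

end Literature.Probability.LatticeModels
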